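import Summits.RiemannHypothesis.RiemannHypothesis.Theorems.SuzukiFlowPairingCausality
import Summits.RiemannHypothesis.RiemannHypothesis.Theorems.SuzukiFlowPairingArchSide
import Summits.RiemannHypothesis.RiemannHypothesis.Theorems.SuzukiKernelHolder
import Summits.RiemannHypothesis.RiemannHypothesis.Theorems.PfPersistenceGalerkinFormMellin

/-!
# The Weil side of `FlowPairing`: regularity and the archimedean series of a θ-flow window output
# (column DBR; RH-FREE)

RH-FREE throughout; nothing here bears on the truth of RH.  For `θ > 1`, a window `(−t,t)` and
`f ∈ L¹(−t,t)`, let `G = 𝖪_θ[t] f` (`winOp`), `g_θ = 𝟙_{(−t,t)} G` read in `ℂ` (`winOut`) and `φ = g_θ ⋆ g̃_θ`.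
This file closes the archimedean part of the WEIL SIDE of `Theorems.SuzukiThetaFlowDefs.FlowPairing`:

* §1 regularity of the output: `G` is bounded on `(−∞,t]` and HÖLDER (`abs_winOp_sub_le`, from the
  Hölder modulus of `K_θ`, `Theorems.SuzukiKernelHolder`), hence continuous; `g_θ` is integrable;
* §2 regularity of `φ`: through the pairing lemma `φ(v) = ∫_{(−t,t)} G(x)G(x−|v|)dx`
  (`Theorems.SuzukiFlowPairingCausality`) `φ` is Hölder (`holder_autocorr_winOut`) and continuous; it is
  positive-definite on the critical line (tree: `PfPersistence.weilMellin_autocorr_half_im/_re_nonneg`);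
* §3 **`hasSum_weilArchIntegral_winOut`** — the archimedean integrand of `φ` is integrable and Bombieri's
  series `Σₙ(4πφ(0)/(n+1) − 4π∫₀^∞(φ(x)+φ(−x))e^{−(2n+½)x}dx) = 2·weilArchIntegral φ + 4πγφ(0)` holds
  (`SuzukiFlowPairing.hasSum_weilArchIntegral_of_posDef`).

So `weilQuadratic g_θ = weilFunctional φ` is an honest (absolutely convergent) explicit-formula value; what
remains of `FlowPairing` is the polar term by evenness and the operator-side bookkeeping
`2⟨𝖪_θ[t]f, 𝒥_θ[t]f⟩ = 2⟨k, φ⟩` (five Fubini swaps of `J_θ = k ∗ K_θ`).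

References: [Su20] M. Suzuki, ASPM 84 (2020); E. Bombieri, Rend. Lincei (9) 11 (2000), §2.
-/

noncomputable section

-- D-0017: `Summit.<S>.<S>.…` is the designed namespace of a single-problem summit.
set_option linter.dupNamespace false

open Complex MeasureTheory Set Filter Topology
open scoped Real

namespace Summit.RiemannHypothesis.RiemannHypothesis.Theorems.SuzukiThetaFlow

open Literature.NumberTheory.LFunctions
open Summit.RiemannHypothesis.RiemannHypothesis.Theorems.SuzukiKernelSemigroup
open Summit.RiemannHypothesis.RiemannHypothesis.Theorems.SuzukiFlowPairing

variable {θ : ℝ}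

/-! ## §1 The window output is bounded, Hölder, continuous -/

/-- RH-FREE.  A bound for `K_θ` on `(−∞, T]`: `|K_θ(w)| ≤ M` for `w ≤ T` (`K_θ` is continuous and vanishes
on `(−∞,0]`). -/
theorem exists_abs_limKernel_le_of_le (hθ : 1 < θ) (T : ℝ) :
    ∃ M : ℝ, 0 ≤ M ∧ ∀ w : ℝ, w ≤ T → |limKernel θ w| ≤ M := by
  obtain ⟨M, hM⟩ := (isCompact_Icc (a := (0 : ℝ)) (b := T)).exists_bound_of_continuousOn
    (Suzuki2020_thm12_continuous hθ).continuousOn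
  refine ⟨max M 0, le_max_right _ _, fun w hw ↦ ?_⟩
  rcases le_or_gt w 0 with h0 | h0
  · rw [limKernel_eq_zero_of_nonpos hθ h0, abs_zero]; exact le_max_right _ _
  · have h := hM w ⟨h0.le, hw⟩
    rw [Real.norm_eq_abs] at h
    exact h.trans (le_max_left _ _)

variable {t : ℝ} {f : ℝ → ℝ}

/-- RH-FREE.  The window integrand `y ↦ K_θ(x+y) f(y)` is integrable on `(−t,t)` for `f ∈ L¹(−t,t)`. -/
theorem integrableOn_kernel_mul (hθ : 1 < θ) (hf : IntegrableOn f (Ioo (-t) t)) (x : ℝ) :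
    IntegrableOn (fun y ↦ limKernel θ (x + y) * f y) (Ioo (-t) t) := by
  obtain ⟨M, -, hM⟩ := exists_abs_limKernel_le_of_le hθ (x + t)
  refine Integrable.bdd_mul (c := M) hf ?_ ?_
  · exact ((Suzuki2020_thm12_continuous hθ).comp (continuous_const.add continuous_id)).aestronglyMeasurable
  · exact (ae_restrict_iff' measurableSet_Ioo).2 (Eventually.of_forall fun y hy ↦ by
      rw [Real.norm_eq_abs]; exact hM _ (by linarith [hy.2]))

/-- RH-FREE.  **The output is bounded on `(−∞, t]`**: `|(𝖪_θ[t]f)(x)| ≤ M` for `x ≤ t`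
(`M = (sup_{[0,2t]}|K_θ|)·‖f‖₁`). -/
theorem exists_abs_winOp_le (hθ : 1 < θ) (hf : IntegrableOn f (Ioo (-t) t)) :
    ∃ M : ℝ, 0 ≤ M ∧ ∀ x : ℝ, x ≤ t → |winOp (limKernel θ) t f x| ≤ M := by
  obtain ⟨MK, hMK0, hMK⟩ := exists_abs_limKernel_le_of_le hθ (2 * t)
  refine ⟨MK * ∫ y in Ioo (-t) t, |f y|, by positivity, fun x hx ↦ ?_⟩
  unfold winOp
  rw [← Real.norm_eq_abs, ← integral_const_mul]
  refine norm_integral_le_of_norm_le (hf.norm.const_mul MK |>.congr (Eventually.of_forall fun y ↦ by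
    simp only [Real.norm_eq_abs])) ?_
  refine (ae_restrict_iff' measurableSet_Ioo).2 (Eventually.of_forall fun y hy ↦ ?_)
  rw [norm_mul, Real.norm_eq_abs, Real.norm_eq_abs]
  exact mul_le_mul_of_nonneg_right (hMK _ (by linarith [hy.2])) (abs_nonneg _)

/-- RH-FREE.  **The output is HÖLDER**: with the modulus `(C, ε)` of `K_θ` (`exists_abs_limKernel_sub_le_rpow`),
`|(𝖪_θ[t]f)(x+h) − (𝖪_θ[t]f)(x)| ≤ C e^{x+|t|} ‖f‖₁ |h|^ε` for `|h| ≤ 1` and every real `x`. -/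
theorem abs_winOp_sub_le (hθ : 1 < θ) (hf : IntegrableOn f (Ioo (-t) t)) :
    ∃ C ε : ℝ, 0 ≤ C ∧ 0 < ε ∧ ε ≤ 1 ∧ ∀ x h : ℝ, |h| ≤ 1 →
      |winOp (limKernel θ) t f (x + h) - winOp (limKernel θ) t f x| ≤
        C * Real.exp (x + |t|) * (∫ y in Ioo (-t) t, |f y|) * |h| ^ ε := by
  obtain ⟨C, ε, hC, hε0, hε1, hK⟩ := exists_abs_limKernel_sub_le_rpow hθ
  refine ⟨C, ε, hC, hε0, hε1, fun x h hh ↦ ?_⟩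
  have hI1 := integrableOn_kernel_mul hθ hf (x + h)
  have hI0 := integrableOn_kernel_mul hθ hf x
  have hsub : winOp (limKernel θ) t f (x + h) - winOp (limKernel θ) t f x =
      ∫ y in Ioo (-t) t, (limKernel θ (x + h + y) - limKernel θ (x + y)) * f y := by
    unfold winOp
    rw [← integral_sub hI1 hI0]
    refine setIntegral_congr_fun measurableSet_Ioo fun y _ ↦ by ring
  have key : ‖∫ y in Ioo (-t) t, (limKernel θ (x + h + y) - limKernel θ (x + y)) * f y‖ ≤
      ∫ y in Ioo (-t) t, (C * Real.exp (x + |t|) * |h| ^ ε) * ‖f y‖ := by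
    refine norm_integral_le_of_norm_le (hf.norm.const_mul _) ?_
    refine (ae_restrict_iff' measurableSet_Ioo).2 (Eventually.of_forall fun y hy ↦ ?_)
    rw [norm_mul, Real.norm_eq_abs, Real.norm_eq_abs]
    have h1 := hK (x + y) h hh
    rw [show x + y + h = x + h + y by ring] at h1
    have h2 : Real.exp (x + y) ≤ Real.exp (x + |t|) :=
      Real.exp_le_exp.2 (by linarith [hy.2, le_abs_self t])
    have h3 : 0 ≤ |h| ^ ε := Real.rpow_nonneg (abs_nonneg h) ε
    calc |limKernel θ (x + h + y) - limKernel θ (x + y)| * |f y|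
        ≤ (C * Real.exp (x + y) * |h| ^ ε) * |f y| := mul_le_mul_of_nonneg_right h1 (abs_nonneg _)
      _ ≤ (C * Real.exp (x + |t|) * |h| ^ ε) * |f y| := by gcongr
  rw [integral_const_mul] at key
  have hL : ∫ y in Ioo (-t) t, ‖f y‖ = ∫ y in Ioo (-t) t, |f y| := by simp only [Real.norm_eq_abs]
  rw [hsub, ← Real.norm_eq_abs]
  calc ‖∫ y in Ioo (-t) t, (limKernel θ (x + h + y) - limKernel θ (x + y)) * f y‖
      ≤ (C * Real.exp (x + |t|) * |h| ^ ε) * ∫ y in Ioo (-t) t, ‖f y‖ := key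
    _ = C * Real.exp (x + |t|) * (∫ y in Ioo (-t) t, |f y|) * |h| ^ ε := by rw [hL]; ring

/-- RH-FREE.  Hence the output is continuous on `ℝ`. -/
theorem continuous_winOp (hθ : 1 < θ) (hf : IntegrableOn f (Ioo (-t) t)) :
    Continuous (winOp (limKernel θ) t f) := by
  obtain ⟨C, ε, hC, hε0, -, hG⟩ := abs_winOp_sub_le hθ hf
  set L : ℝ := ∫ y in Ioo (-t) t, |f y| with hL
  refine continuous_iff_continuousAt.2 fun x ↦ ?_
  rw [ContinuousAt, tendsto_iff_norm_sub_tendsto_zero]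
  have h1 : Tendsto (fun x' : ℝ ↦ x' - x) (𝓝 x) (𝓝 0) := by
    have h := (tendsto_id (x := 𝓝 x)).sub_const x
    rwa [sub_self] at h
  have h2 : Tendsto (fun x' : ℝ ↦ |x' - x| ^ ε) (𝓝 x) (𝓝 0) := by
    have h := (h1.abs).rpow_const (p := ε) (Or.inr hε0.le)
    rwa [abs_zero, Real.zero_rpow hε0.ne'] at h
  have hlim := h2.const_mul (C * Real.exp (x + |t|) * L)
  rw [mul_zero] at hlim
  refine squeeze_zero' (Eventually.of_forall fun _ ↦ norm_nonneg _) ?_ hlim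
  have hball : ∀ᶠ x' in 𝓝 x, |x' - x| ≤ 1 := by
    have : Icc (x - 1) (x + 1) ∈ 𝓝 x := Icc_mem_nhds (by linarith) (by linarith)
    filter_upwards [this] with x' hx'
    exact abs_le.2 ⟨by linarith [hx'.1], by linarith [hx'.2]⟩
  filter_upwards [hball] with x' hx'
  have h := hG x (x' - x) hx'
  rw [add_sub_cancel] at h
  rwa [Real.norm_eq_abs]

/-- RH-FREE.  The window output `g_θ` is integrable on `ℝ`. -/
theorem integrable_winOut (hθ : 1 < θ) (hf : IntegrableOn f (Ioo (-t) t)) : Integrable (winOut θ t f) := by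
  have hG : IntegrableOn (winOp (limKernel θ) t f) (Ioo (-t) t) :=
    ((continuous_winOp hθ hf).continuousOn.integrableOn_compact isCompact_Icc).mono_set Ioo_subset_Icc_self
  have h := (integrable_indicator_iff measurableSet_Ioo).2 hG
  exact h.ofReal (𝕜 := ℂ)

/-! ## §2 The autocorrelation `φ = g_θ ⋆ g̃_θ` is Hölder, continuous, positive-definite -/

/-- RH-FREE.  **`φ` is HÖLDER**: there are `C ≥ 0`, `0 < α` with `‖φ(a + y) − φ(a)‖ ≤ C|y|^α` for all `a`
and `|y| ≤ 1` (pairing lemma `φ(v) = ∫_{(−t,t)} G(x)G(x−|v|)dx`, Hölder bound for `G` at base points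
`≤ t`, `||a+y| − |a|| ≤ |y|`). -/
theorem holder_autocorr_winOut (hθ : 1 < θ) (hf : IntegrableOn f (Ioo (-t) t)) :
    ∃ C α : ℝ, 0 ≤ C ∧ 0 < α ∧ ∀ a y : ℝ, |y| ≤ 1 →
      ‖weilConv (winOut θ t f) (weilReflect (winOut θ t f)) (a + y) -
        weilConv (winOut θ t f) (weilReflect (winOut θ t f)) a‖ ≤ C * |y| ^ α := by
  obtain ⟨M, hM0, hM⟩ := exists_abs_winOp_le hθ hf
  obtain ⟨C, ε, hC, hε0, hε1, hG⟩ := abs_winOp_sub_le hθ hf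
  set L : ℝ := ∫ y in Ioo (-t) t, |f y| with hL
  have hL0 : 0 ≤ L := integral_nonneg fun _ ↦ abs_nonneg _
  set B : ℝ := M * (C * Real.exp (t + |t|) * L) with hB
  refine ⟨B * (volume (Ioo (-t) t)).toReal, ε, by positivity, hε0, fun a y hy ↦ ?_⟩
  rw [weilConv_winOut_weilReflect_eq_abs hθ t f (a + y), weilConv_winOut_weilReflect_eq_abs hθ t f a,
    ← Complex.ofReal_sub, Complex.norm_real]
  have hIa : ∀ c : ℝ, IntegrableOn (fun x ↦ winOp (limKernel θ) t f x * winOp (limKernel θ) t f (x - c))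
      (Ioo (-t) t) := fun c ↦
    (((continuous_winOp hθ hf).mul ((continuous_winOp hθ hf).comp (continuous_id.sub continuous_const))
      ).continuousOn.integrableOn_compact isCompact_Icc).mono_set Ioo_subset_Icc_self
  rw [← integral_sub (hIa _) (hIa _)]
  have hvol : volume (Ioo (-t) t) < ⊤ := measure_Ioo_lt_top
  have hpt : ∀ x ∈ Ioo (-t) t, ‖winOp (limKernel θ) t f x * winOp (limKernel θ) t f (x - |a + y|) -
      winOp (limKernel θ) t f x * winOp (limKernel θ) t f (x - |a|)‖ ≤ B * |y| ^ ε := by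
    intro x hx
    rw [← mul_sub, norm_mul, Real.norm_eq_abs, Real.norm_eq_abs]
    have hh : |(|a| - |a + y|)| ≤ |y| := by
      have := abs_abs_sub_abs_le_abs_sub a (a + y)
      rw [show a - (a + y) = -y by ring, abs_neg] at this
      exact this
    have h1 := hG (x - |a|) (|a| - |a + y|) (hh.trans hy)
    rw [show x - |a| + (|a| - |a + y|) = x - |a + y| by ring] at h1
    have h2 : Real.exp (x - |a| + |t|) ≤ Real.exp (t + |t|) :=
      Real.exp_le_exp.2 (by linarith [hx.2, abs_nonneg a])
    have h3 : |(|a| - |a + y|)| ^ ε ≤ |y| ^ ε := Real.rpow_le_rpow (abs_nonneg _) hh hε0.le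
    have h4 : 0 ≤ |y| ^ ε := Real.rpow_nonneg (abs_nonneg y) ε
    calc |winOp (limKernel θ) t f x| * |winOp (limKernel θ) t f (x - |a + y|) - winOp (limKernel θ) t f (x - |a|)|
        ≤ M * (C * Real.exp (x - |a| + |t|) * L * |(|a| - |a + y|)| ^ ε) :=
          mul_le_mul (hM x hx.2.le) h1 (abs_nonneg _) hM0
      _ ≤ M * (C * Real.exp (t + |t|) * L * |y| ^ ε) := by gcongr
      _ = B * |y| ^ ε := by rw [hB]; ring
  have h := norm_setIntegral_le_of_norm_le_const hvol hpt
  rw [Real.norm_eq_abs] at h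
  calc |∫ x in Ioo (-t) t, (winOp (limKernel θ) t f x * winOp (limKernel θ) t f (x - |a + y|) -
        winOp (limKernel θ) t f x * winOp (limKernel θ) t f (x - |a|))|
      ≤ B * |y| ^ ε * (volume (Ioo (-t) t)).toReal := h
    _ = B * (volume (Ioo (-t) t)).toReal * |y| ^ ε := by ring

/-- RH-FREE.  A function with a uniform Hölder modulus is continuous. -/
theorem continuous_of_holder {φ : ℝ → ℂ} {C α : ℝ} (hα : 0 < α)
    (hH : ∀ a y : ℝ, |y| ≤ 1 → ‖φ (a + y) - φ a‖ ≤ C * |y| ^ α) : Continuous φ := by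
  refine continuous_iff_continuousAt.2 fun a ↦ ?_
  rw [ContinuousAt, tendsto_iff_norm_sub_tendsto_zero]
  have h1 : Tendsto (fun x : ℝ ↦ x - a) (𝓝 a) (𝓝 0) := by
    have h := (tendsto_id (x := 𝓝 a)).sub_const a
    rwa [sub_self] at h
  have h2 : Tendsto (fun x : ℝ ↦ |x - a| ^ α) (𝓝 a) (𝓝 0) := by
    have h := (h1.abs).rpow_const (p := α) (Or.inr hα.le)
    rwa [abs_zero, Real.zero_rpow hα.ne'] at h
  have hlim := h2.const_mul C
  rw [mul_zero] at hlim
  refine squeeze_zero' (Eventually.of_forall fun _ ↦ norm_nonneg _) ?_ hlim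
  have hball : ∀ᶠ x in 𝓝 a, |x - a| ≤ 1 := by
    have : Icc (a - 1) (a + 1) ∈ 𝓝 a := Icc_mem_nhds (by linarith) (by linarith)
    filter_upwards [this] with x hx
    exact abs_le.2 ⟨by linarith [hx.1], by linarith [hx.2]⟩
  filter_upwards [hball] with x hx
  have h := hH a (x - a) hx
  rwa [add_sub_cancel] at h

/-- RH-FREE.  `φ` is continuous. -/
theorem continuous_autocorr_winOut (hθ : 1 < θ) (hf : IntegrableOn f (Ioo (-t) t)) :
    Continuous (weilConv (winOut θ t f) (weilReflect (winOut θ t f))) := by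
  obtain ⟨C, α, -, hα, hH⟩ := holder_autocorr_winOut hθ hf
  exact continuous_of_holder hα hH

/-- RH-FREE.  **`φ` is positive-definite on the critical line**: `φ̂(½+iy)` is real and `≥ 0`
(`= |ĝ_θ(½+iy)|²`; tree `PfPersistence.weilMellin_autocorr_half_im/_re_nonneg`, `g_θ` integrable). -/
theorem weilMellin_autocorr_winOut_half (hθ : 1 < θ) (hf : IntegrableOn f (Ioo (-t) t)) (y : ℝ) :
    (weilMellin (weilConv (winOut θ t f) (weilReflect (winOut θ t f))) (1 / 2 + y * I)).im = 0 ∧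
    0 ≤ (weilMellin (weilConv (winOut θ t f) (weilReflect (winOut θ t f))) (1 / 2 + y * I)).re :=
  ⟨PfPersistence.weilMellin_autocorr_half_im (integrable_winOut hθ hf) y,
    PfPersistence.weilMellin_autocorr_half_re_nonneg (integrable_winOut hθ hf) y⟩

/-! ## §3 The archimedean series of the window output -/

/-- **RH-FREE · THE ARCHIMEDEAN SIDE OF `FlowPairing`**: for `θ > 1`, a window `(−t,t)`, `f ∈ L¹(−t,t)`
and `φ = g_θ ⋆ g̃_θ` (`g_θ = winOut θ t f`): the archimedean integrand `φ̂(½+iy)·Re ψ(¼+iy/2)` of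
`weilArchIntegral φ` is integrable, and
`Σₙ (4π φ(0)/(n+1) − 4π ∫₀^∞ (φ(x)+φ(−x)) e^{−(2n+½)x} dx) = 2·weilArchIntegral φ + 4πγ φ(0)`.
Nothing here bears on RH. -/
theorem hasSum_weilArchIntegral_winOut (hθ : 1 < θ) (hf : IntegrableOn f (Ioo (-t) t)) :
    Integrable (fun y : ℝ ↦ weilMellin (weilConv (winOut θ t f) (weilReflect (winOut θ t f))) (1 / 2 + y * I) *
      ((digamma (1 / 4 + y / 2 * I)).re : ℂ)) ∧
    HasSum (fun n : ℕ ↦ 4 * π * weilConv (winOut θ t f) (weilReflect (winOut θ t f)) 0 / ((n : ℂ) + 1) -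
        4 * π * ∫ x in Ioi (0 : ℝ), (weilConv (winOut θ t f) (weilReflect (winOut θ t f)) x +
          weilConv (winOut θ t f) (weilReflect (winOut θ t f)) (-x)) * cexp ((-(2 * (n : ℂ)) - 1 / 2) * x))
      (2 * weilArchIntegral (weilConv (winOut θ t f) (weilReflect (winOut θ t f))) +
        4 * π * Real.eulerMascheroniConstant * weilConv (winOut θ t f) (weilReflect (winOut θ t f)) 0) := by
  obtain ⟨C, α, hC, hα, hH⟩ := holder_autocorr_winOut hθ hf
  exact hasSum_weilArchIntegral_of_posDef (continuous_of_holder hα hH)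
    (hasCompactSupport_weilConv_winOut_weilReflect hθ t f) (weilMellin_autocorr_winOut_half hθ hf) hC hα hH

end Summit.RiemannHypothesis.RiemannHypothesis.Theorems.SuzukiThetaFlow

end
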